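import Summits.BirchSwinnertonDyer.BirchSwinnertonDyer.Theorems.SignedLowerHalvesKobayashiLowerHalfLargeImageBSTWTwistRecordShape
import Summits.BirchSwinnertonDyer.BirchSwinnertonDyer.Theorems.SignedLowerHalvesKobayashiLowerHalfLargeImageBSTWTwistConsumers
import Summits.BirchSwinnertonDyer.Rank1Residual.Supersingular.KobayashiMainConjectureX7BSTWScopeS
import Summits.BirchSwinnertonDyer.Rank1Residual.X11b.VisibilityPrimeList
import Literature.NumberTheory.EllipticCurves.SupersingularDensitySerreFrobeniusProofs
import Mathlib.Tactic.NormNum.LegendreSymbol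
import HarnessLib

/-!
# Route `SignedLowerHalves`, crux `KobayashiLowerHalfLargeImage` (item stmt-BirchSwinnertonDyer-19001): the BSTW-TWIST
# SUB-FAMILY of class X7 ON THE TWIST SCOPE `S_tw` of the litref D-audit — PER-PAIR RECORD SHAPE and CLASS-WIDE CONSUMERS
# (cell `pub/bsd-litref`, paper sub-dir `bstw24`, prover seat `bsd-litref-bstw24-pv` gen 6; companion of
# `…BSTWTwistRecordShape.lean` (p496534) / `…BSTWTwistConsumers.lean` (p496619) and of the typer's
# `Supersingular/KobayashiMainConjectureX7BSTWScopeS.lean` (p500588); a `--supports … --as helper` file; THEOREMS ONLY; closes nothing)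

HONEST FRAMING (programme BSD-LIT2PART v1 §HONESTY, verbatim): «no tranche here proves BSD; ARM L moves the LITERAL column of
an r ≤ 1 census into the kernel-proved-modulo-named-print column; ARM P changes what "named print" is worth.»
Burungale–Skinner–Tian–Wan arXiv:2409.01350v2 is an UNREFEREED PREPRINT; its twist clause enters ONLY through explicitly labelled
OPEN binders taken as hypotheses — here the `S_tw`-SCOPED tiers `BurungaleSkinnerTianWan2024_cor102_twist_scopedS_OPEN` (`p ≥ 5`)
/ `…_scopedAtThreeS_OPEN` (`p = 3`) of `KobayashiMainConjectureX7BSTWScopeS.lean` —, never as theorems. Records ≠ bookings ≠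
crux closure; class X7 stays CONSTRUCTION-SHAPED; crux 3 stays OPEN; the desk words any tier; typed ≠ proved ≠ endorsed.

THE SCOPE (litref D-audit of the twist clause, sheets `pub/bsd-litref/bstw24/sheets/D-AUDIT-bstw24-r2-TWIST.md` 12a33d6b (V3) and
`…-r1-TWIST-ADDENDUM-1.md` 16a3b3ee (1), CONCUR; referee C4 ROUND C4-R3-ADD-6: (β) road B1 GAP(line) T1 ∧ T2b, (γ) road B2
PASS-in-cell(scope S_tw^aux), (b) scope object NAMED = STRICT first alternative, typed by p500588): the printed proof
of the twist clause run at level `N·d_K²` (road B1) is GAP(line) at Thm. 9.24's twist paragraph (l.7282–7285) and at the μ-step;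
the gap-free road B2 is §10.3 run with `L := K`, i.e. the twisting field `K = ℚ(√d)` is ITSELF an admissible auxiliary field for
`(E₀, p)`: `BSTWScope.IsAuxiliaryTwist W₀ p d` (`∃ q K`, `K` quadratic of discriminant `d`, `IsAuxiliaryPrime W₀ p q`,
`IsAuxiliaryField W₀ p q K`: `K` imaginary, `p` split, the (ram) prime `q` inert, every other bad prime of `E₀` split, `d` odd
and prime to the bad primes, `2` split if good). Per pair this is DECIDABLE data (`BSTWScope.isAuxiliaryTwist_of_kronecker`); its
census footprint on the 415 BSTW-twist pairs of `x7census.tsv` is 5 pairs in the strict reading (seat file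
`staging/bsd-litref-bstw24-pv/X7-BSTWTWIST-SCOPE-AUX.md`).

## What this file proves (namespace `Summit.BirchSwinnertonDyer.BirchSwinnertonDyer.Theorems.X7Twist`)

* `isAuxiliaryPrime_of_certs` — `BSTWScope.IsAuxiliaryPrime W₀ p q` for the literal minimal `W₀` from `q ∣ Δ₀`, `q ∤ c₄`,
  `q^v ∥ Δ₀`, `p ∤ v` (Silverman VII.5.1(b); `IntModel`).
* `mem_of_not_hasGoodReductionAtPrime` — every bad prime of the literal minimal `W₀` lies in the prime list of a factorisation
  certificate `|Δ₀| = ∏ qᵢ^eᵢ` (`X11b.forall_mem_of_natAbs_eq_prod_pow`), so the scope's «every other bad prime» clauses become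
  checks over an explicit list.
* `exists_twistAux_of_certs` — the SCOPED TWIST DATUM of a pair, UNCONDITIONAL and binder-free: the BODY datum of
  `exists_twistBody_of_certs` ∧ `BSTWScope.IsAuxiliaryTwist W₀ p d`, from the body certificates plus the Kronecker data of `d`
  (`jacobiSym`, `norm_num`-decidable) against `p`, the (ram) prime and the listed bad primes, through the typer's kernel lemma
  `BSTWScope.isAuxiliaryTwist_of_kronecker` (full decomposition law at the (ram) prime, `q = 2` inert ⟺ `d ≡ 5 (mod 8)`; p500588).
* `kobayashiMainConjecture_of_thm101_twist_scopedS_OPEN_of_twistAux`, `exists_kobayashiLowerDivisibility_of_thm101_twist_scoped{S,AtThreeS}_OPEN_of_twistAux`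
  — the crux's own conclusion `∃ ε, KobayashiLowerDivisibility W p ε` at a scoped twist, CONDITIONAL on the MC-level scoped tier.
* `bsdp_of_cor102_twist_scopedS_OPEN_of_twistAux` / `…scopedAtThreeS_OPEN_of_twistAux` — the CLASS-WIDE consumers: `BSDp W p`
  from a scoped datum, CONDITIONAL on the scoped tier (+ GZK by name + the analytic rank `≤ 1` as DATA), via the typer's bridges
  `bsdp_of_cor102_twist_scoped{S,AtThreeS}_OPEN` (`Irr W p` from the twist's own supersingularity, `X7Twist.goodSS_of_twistBody`).

Design: THEOREMS ONLY; default heartbeats; axioms standard. References: [BurungaleSkinnerTianWan2024] Cor. 10.2 (p. 86), §10.3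
(l.7454–7479); [Cox2013] §7.B Thm. 7.7(ii) (decomposition law); [SilvermanAEC2009] VII.5 Prop. 5.1; [SkinnerUrban2014] Thm. 2 ((ram));
[Miller2011LMS] Def. 1.1.
-/

set_option autoImplicit false
set_option linter.dupNamespace false

noncomputable section

open scoped Classical

open WeierstrassCurve Literature.NumberTheory.EllipticCurves
  Literature.NumberTheory.EllipticCurves.Rank1Residual
  Literature.NumberTheory.EllipticCurves.Rank1Residual.X11RankOneCertificates
  Literature.NumberTheory.EllipticCurves.BurungaleSkinnerTianWan2024
  Summit.BirchSwinnertonDyer.BirchSwinnertonDyer.Rank1Residual.IntModel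
  Summit.BirchSwinnertonDyer.BirchSwinnertonDyer.Rank1Residual.X11RankOne
  Summit.BirchSwinnertonDyer.Rank1Residual.X11b
  Summit.BirchSwinnertonDyer.Rank1Residual.Supersingular
  Summit.BirchSwinnertonDyer.Rank1Residual.SecondDescent

namespace Summit.BirchSwinnertonDyer.BirchSwinnertonDyer.Theorems.X7Twist

/-! ### §1 Scope certificates on the literal model of `E₀` -/

section AuxCerts

variable (p : ℕ) [Fact p.Prime] (b1 b2 b3 b4 b6 : ℤ)
  [hEb : (⟨b1, b2, b3, b4, b6⟩ : WeierstrassCurve ℚ).IsElliptic]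
  [hMb : (⟨b1, b2, b3, b4, b6⟩ : WeierstrassCurve ℚ).IsGloballyMinimal]

omit [Fact p.Prime] in
/-- **The (ram) prime of `E₀` from certificates**: `q ≠ p`, `q ∣ Δ₀`, `q ∤ c₄(E₀)` (multiplicative reduction, Silverman
VII.5.1(b)), `q^v ∥ Δ₀ = Δ_min(E₀)` and `p ∤ v` give `BSTWScope.IsAuxiliaryPrime E₀ p q`. Per pair; UNCONDITIONAL.
[cite: SilvermanAEC2009, VII.5 Prop. 5.1(b)] [cite: SkinnerUrban2014, Thm. 2 (p. 3), second bullet (shape of (ram) only)] -/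
theorem isAuxiliaryPrime_of_certs (q v : ℕ) [hq : Fact q.Prime] (hqp : q ≠ p)
    (hqΔ : (q : ℤ) ∣ discOf [b1, b2, b3, b4, b6]) (hqc₄ : ¬ (q : ℤ) ∣ c4Of [b1, b2, b3, b4, b6])
    (hv : (q : ℤ) ^ v ∣ discOf [b1, b2, b3, b4, b6]) (hv' : ¬ (q : ℤ) ^ (v + 1) ∣ discOf [b1, b2, b3, b4, b6])
    (hpv : ¬ p ∣ v) : BSTWScope.IsAuxiliaryPrime (⟨b1, b2, b3, b4, b6⟩ : WeierstrassCurve ℚ) p q := by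
  have hIb := integralModelInt_lit b1 b2 b3 b4 b6
  refine ⟨hqp, hasMultiplicativeReductionAtPrime_of_intModel hIb q (by rw [intCurve_Δ]; exact hqΔ)
    (by rw [intCurve_c₄]; exact hqc₄), ?_⟩
  rw [minimalDiscriminantInt_eq hIb, intCurve_Δ, padicValInt_eq_of_dvd_of_not_dvd q hv hv']
  exact hpv

omit hEb in
/-- **Every bad prime of the literal minimal `E₀` is in the factorisation list**: from `|Δ₀| = ∏ (q, e) ∈ F, q^e` with every
`q` prime, a prime `ℓ` of bad reduction divides `Δ_min = Δ₀` (`natCast_dvd_minimalDiscriminantInt_of_not_hasGoodReductionAtPrime`)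
and hence is one of the listed primes (`X11b.forall_mem_of_natAbs_eq_prod_pow`). Bookkeeping. [cite: SilvermanAEC2009, VII.5 Prop. 5.1(a)] -/
theorem mem_of_not_hasGoodReductionAtPrime (F : List (ℕ × ℕ))
    (hF : (discOf [b1, b2, b3, b4, b6]).natAbs = (F.map fun qe => qe.1 ^ qe.2).prod)
    (hpr : ∀ qe ∈ F, qe.1.Prime) (ℓ : ℕ) (hℓ : ℓ.Prime)
    (hbad : haveI : Fact ℓ.Prime := ⟨hℓ⟩; ¬ (⟨b1, b2, b3, b4, b6⟩ : WeierstrassCurve ℚ).HasGoodReductionAtPrime ℓ) :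
    ℓ ∈ F.map Prod.fst := by
  haveI : Fact ℓ.Prime := ⟨hℓ⟩
  have hIb := integralModelInt_lit b1 b2 b3 b4 b6
  have hd := natCast_dvd_minimalDiscriminantInt_of_not_hasGoodReductionAtPrime
    (W := (⟨b1, b2, b3, b4, b6⟩ : WeierstrassCurve ℚ)) ℓ hbad
  rw [minimalDiscriminantInt_eq hIb, intCurve_Δ] at hd
  have hzip : (F.map Prod.fst).zip (F.map Prod.snd) = F := by
    rw [← List.unzip_fst, ← List.unzip_snd, List.zip_unzip]
  refine forall_mem_of_natAbs_eq_prod_pow (F.map Prod.fst) (F.map Prod.snd)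
    (fun q hq ↦ ?_) (by rw [hzip]; exact hF) ℓ hℓ hd
  obtain ⟨qe, hqe, rfl⟩ := List.mem_map.mp hq
  exact hpr qe hqe


end AuxCerts

/-! ### §2 The scoped twist datum of a pair -/

section ScopedDatum

variable (p : ℕ) [Fact p.Prime]
  (a1 a2 a3 a4 a6 b1 b2 b3 b4 b6 : ℤ)
  [hEb : (⟨b1, b2, b3, b4, b6⟩ : WeierstrassCurve ℚ).IsElliptic]
  [hMb : (⟨b1, b2, b3, b4, b6⟩ : WeierstrassCurve ℚ).IsGloballyMinimal]

/-- **The SCOPED twist datum of a pair from certificates (road B2).** As `exists_twistBody_of_certs` (the BODY-wording datum: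
`W₀` semistable, `p` good supersingular for `W₀` with `a_p = 0`, `d` square-free `≠ 1`, every ramified prime of `ℚ(√d)` `≠ p`
and good for `W₀`, `C • W = W₀^{(d)}`) AND `BSTWScope.IsAuxiliaryTwist W₀ p d` — the twisting field `ℚ(√d)` is itself an
admissible auxiliary field for `(E₀, p)` — from, in addition: the factorisation `|Δ₀| = ∏ F` (bad primes of `E₀` = the primes of
`F`), a (ram) prime `q` of `E₀` (`q^v ∥ Δ₀`, `q ∤ c₄`, `p ∤ v`), `d < 0`, `d ≡ 1 (mod 4)`, `(d/p) = +1`, `(d/q) = −1`, no listed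
prime divides `d`, every listed prime `ℓ ≠ q` split in `ℚ(√d)` (`(d/ℓ) = +1`; `d ≡ 1 (mod 8)` at `ℓ = 2`), and `d ≡ 1 (mod 8)`
when `2` is not listed (`BSTWScope.isAuxiliaryTwist_of_kronecker`, Cox Thm. 7.7(ii)). UNCONDITIONAL; per pair; nothing booked.
[cite: Cox2013, §7.B Thm. 7.7(ii)] [cite: SilvermanAEC2009, III.1 Table 3.1, VII.5 Prop. 5.1]
[cite: SkinnerUrban2014, Thm. 2 (p. 3), second bullet (shape of (ram) only)] -/
theorem exists_twistAux_of_certs (hp2 : p ≠ 2) (d : ℤ) (u r s t : ℚ) (hu : u ≠ 0)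
    (h1 : (a1 : ℚ) + 2 * s = 0)
    (h2' : (a2 : ℚ) - s * a1 + 3 * r - s ^ 2 = u ^ 2 * ((d : ℚ) * ((b1 : ℚ) ^ 2 + 4 * b2) / 4))
    (h3 : (a3 : ℚ) + r * a1 + 2 * t = 0)
    (h4 : (a4 : ℚ) - s * a3 + 2 * r * a2 - (t + r * s) * a1 + 3 * r ^ 2 - 2 * s * t =
      u ^ 4 * ((d : ℚ) ^ 2 * (2 * (b4 : ℚ) + b1 * b3) / 2))
    (h6 : (a6 : ℚ) + r * a4 + r ^ 2 * a2 + r ^ 3 - t * a3 - t ^ 2 - r * t * a1 =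
      u ^ 6 * ((d : ℚ) ^ 3 * ((b3 : ℚ) ^ 2 + 4 * b6) / 4))
    (hgcd : Int.gcd (discOf [b1, b2, b3, b4, b6]) (c4Of [b1, b2, b3, b4, b6]) = 1)
    (hpΔ : ¬ (p : ℤ) ∣ discOf [b1, b2, b3, b4, b6]) (hcnt : countPoints [b1, b2, b3, b4, b6] p = (p + 1 : ℕ))
    (hd : ∀ q < d.natAbs + 1, 2 ≤ q → ¬ q * q ∣ d.natAbs) (hd0 : d ≠ 0) (hd1 : d ≠ 1) (L : List ℕ)
    (hLcov : ∀ q < d.natAbs + 1, q.Prime → q ∣ d.natAbs → q = 2 ∨ q ∈ L)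
    (hL : ∀ q ∈ L, q.Prime ∧ q ≠ p ∧ ¬ (q : ℤ) ∣ discOf [b1, b2, b3, b4, b6])
    (h2 : d % 4 ≠ 1 → ¬ (2 : ℤ) ∣ discOf [b1, b2, b3, b4, b6])
    -- the scope data
    (F : List (ℕ × ℕ)) (hF : (discOf [b1, b2, b3, b4, b6]).natAbs = (F.map fun qe => qe.1 ^ qe.2).prod)
    (hpr : ∀ qe ∈ F, qe.1.Prime) (q v : ℕ) (hq : q.Prime) (hqp : q ≠ p)
    (hqΔ : (q : ℤ) ∣ discOf [b1, b2, b3, b4, b6]) (hqc₄ : ¬ (q : ℤ) ∣ c4Of [b1, b2, b3, b4, b6])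
    (hv : (q : ℤ) ^ v ∣ discOf [b1, b2, b3, b4, b6]) (hv' : ¬ (q : ℤ) ^ (v + 1) ∣ discOf [b1, b2, b3, b4, b6])
    (hpv : ¬ p ∣ v) (hdneg : d < 0) (hd4 : d % 4 = 1)
    (hsp : jacobiSym d p = 1) (hin : (q = 2 → d % 8 = 5) ∧ (q ≠ 2 → jacobiSym d q = -1))
    (hFd : ∀ qe ∈ F, ¬ (qe.1 : ℤ) ∣ d)
    (hFsplit : ∀ qe ∈ F, qe.1 ≠ q → (qe.1 = 2 → d % 8 = 1) ∧ (qe.1 ≠ 2 → jacobiSym d qe.1 = 1))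
    (h2split : ¬ (2 : ℤ) ∣ discOf [b1, b2, b3, b4, b6] → d % 8 = 1) :
    ∃ (W₀ : WeierstrassCurve ℚ) (_ : W₀.IsElliptic) (_ : W₀.IsGloballyMinimal) (d : ℤ) (C : VariableChange ℚ),
      Semistable W₀ ∧ GoodSS W₀ p ∧ W₀.frobeniusTrace p = 0 ∧ Squarefree d ∧ d ≠ 1 ∧
      (∀ (q : ℕ) [Fact q.Prime], RamifiedInQuadratic d q → q ≠ p ∧ W₀.HasGoodReductionAtPrime q) ∧
      C • (⟨a1, a2, a3, a4, a6⟩ : WeierstrassCurve ℚ) = W₀.quadraticTwist (d : ℚ) ∧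
      BSTWScope.IsAuxiliaryTwist W₀ p d := by
  haveI : Fact q.Prime := ⟨hq⟩
  have hIb := integralModelInt_lit b1 b2 b3 b4 b6
  have haux := isAuxiliaryPrime_of_certs p b1 b2 b3 b4 b6 q v hqp hqΔ hqc₄ hv hv' hpv
  have hmem := mem_of_not_hasGoodReductionAtPrime b1 b2 b3 b4 b6 F hF hpr
  have hsst := semistable_of_certs b1 b2 b3 b4 b6 hgcd
  have hss := goodSS_of_certs b1 b2 b3 b4 b6 p hp2 hpΔ hcnt
  have hap := frobeniusTrace_eq_zero_of_certs b1 b2 b3 b4 b6 p hp2 hpΔ hcnt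
  have hdn : Squarefree d.natAbs := by
    intro x hx
    have hn0 : d.natAbs ≠ 0 := Int.natAbs_ne_zero.mpr hd0
    have hxle : x ≤ d.natAbs := Nat.le_of_dvd (Nat.pos_of_ne_zero hn0) (dvd_trans (dvd_mul_right x x) hx)
    by_contra hx1
    rw [Nat.isUnit_iff] at hx1
    have hx0 : x ≠ 0 := by rintro rfl; exact hn0 (Nat.eq_zero_of_zero_dvd (by simpa using hx))
    exact hd x (Nat.lt_succ_of_le hxle) (by omega) hx
  have hd' : Squarefree d := Int.squarefree_natAbs.mp hdn
  have hgoodq : ∀ (q : ℕ) [Fact q.Prime], ¬ (q : ℤ) ∣ discOf [b1, b2, b3, b4, b6] →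
      (⟨b1, b2, b3, b4, b6⟩ : WeierstrassCurve ℚ).HasGoodReductionAtPrime q := fun q _ hqΔ ↦
    hasGoodReductionAtPrime_of_not_dvd _ q (by rw [minimalDiscriminantInt_eq hIb, intCurve_Δ]; exact hqΔ)
  have hram : ∀ (q : ℕ) [Fact q.Prime], RamifiedInQuadratic d q →
      q ≠ p ∧ (⟨b1, b2, b3, b4, b6⟩ : WeierstrassCurve ℚ).HasGoodReductionAtPrime q := by
    intro q hq h
    rcases ramifiedInQuadratic_cases hd' hq.out h with ⟨rfl, hd4'⟩ | ⟨hq2, hqd, hqlt⟩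
    · exact ⟨Ne.symm hp2, hgoodq 2 (h2 hd4')⟩
    · have hm : q ∈ L := (hLcov q hqlt hq.out hqd).resolve_left hq2
      obtain ⟨-, hqp', hqΔ'⟩ := hL q hm
      exact ⟨hqp', hgoodq q hqΔ'⟩
  have hC := smul_eq_quadraticTwist_of_eqs a1 a2 a3 a4 a6 b1 b2 b3 b4 b6 d u r s t hu h1 h2' h3 h4 h6
  -- the scope: `d = -D`, Kronecker data, bad primes from the factor list
  obtain ⟨D, rfl⟩ : ∃ D : ℕ, d = -(D : ℤ) := ⟨d.natAbs, by omega⟩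
  have htw : BSTWScope.IsAuxiliaryTwist (⟨b1, b2, b3, b4, b6⟩ : WeierstrassCurve ℚ) p (-(D : ℤ)) := by
    refine BSTWScope.isAuxiliaryTwist_of_kronecker _ p hp2 q haux D ⟨hd4, hd', hd1⟩ hsp hin ?_ ?_ ?_
    · intro ℓ hℓ hbadℓ
      obtain ⟨qe, hqe, rfl⟩ := List.mem_map.mp (hmem ℓ hℓ hbadℓ)
      have h := hFd qe hqe
      rwa [Int.dvd_neg] at h
    · intro ℓ hℓ hℓq hbadℓ
      obtain ⟨qe, hqe, rfl⟩ := List.mem_map.mp (hmem ℓ hℓ hbadℓ)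
      exact hFsplit qe hqe hℓq
    · intro hgood2
      haveI : Fact (Nat.Prime 2) := ⟨Nat.prime_two⟩
      refine h2split ?_
      have h := WeierstrassCurve.not_dvd_minimalDiscriminantInt_of_hasGoodReductionAtPrime'
        (⟨b1, b2, b3, b4, b6⟩ : WeierstrassCurve ℚ) 2 hgood2
      rw [minimalDiscriminantInt_eq hIb, intCurve_Δ] at h
      exact_mod_cast h
  exact ⟨_, hEb, hMb, _, _, hsst, hss, hap, hd', hd1, hram, hC, htw⟩

end ScopedDatum

/-! ### §3 Class-wide consumers of a scoped twist datum (the scoped tiers enter HERE, as hypotheses) -/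

section ScopedConsumers

variable (W : WeierstrassCurve ℚ) [W.IsElliptic] [W.IsGloballyMinimal] (p : ℕ) [Fact p.Prime]

/-- **`BSD(E, p)` from a SCOPED twist datum, CONDITIONAL on the `p ≥ 5` scoped tier of BSTW's twist clause (Cor. 10.2, road
B2).** Binders: the PRE hypothesis `BurungaleSkinnerTianWan2024_cor102_twist_scopedS_OPEN` (UNREFEREED preprint restricted to the
litref scope; never a theorem), GZK `hGZK` (PUBLISHED, by name), the pair's analytic rank `rk ≤ 1` (DATA). `Irr W p` from the
twist's own good supersingular reduction (`goodSS_of_twistBody`, Serre 1972 Prop. 12); ramified primes good ⟹ prime to `N₀`.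
Via the typer's bridge `bsdp_of_cor102_twist_scopedS_OPEN`. Closes nothing; X7 stays CONSTRUCTION-SHAPED.
[claim: BurungaleSkinnerTianWan2024, status: under-review]
[cite: BurungaleSkinnerTianWan2024, Cor. 10.2, last sentence (p. 86) with §10.3 (l.7454–7479) (ANNOUNCED, OPEN binder, scoped)]
[cite: Serre1972, §1.11 Prop. 12] [cite: Miller2011LMS, §1 and Def. 1.1] -/
theorem bsdp_of_cor102_twist_scopedS_OPEN_of_twistAux
    (hBSTW : BurungaleSkinnerTianWan2024_cor102_twist_scopedS_OPEN)
    (hGZK : rank_eq_analyticRank_of_analyticRank_le_one) (hp5 : 5 ≤ p)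
    (htw : ∃ (W₀ : WeierstrassCurve ℚ) (_ : W₀.IsElliptic) (_ : W₀.IsGloballyMinimal) (d : ℤ) (C : VariableChange ℚ),
      Semistable W₀ ∧ GoodSS W₀ p ∧ W₀.frobeniusTrace p = 0 ∧ Squarefree d ∧ d ≠ 1 ∧
      (∀ (q : ℕ) [Fact q.Prime], RamifiedInQuadratic d q → q ≠ p ∧ W₀.HasGoodReductionAtPrime q) ∧
      C • W = W₀.quadraticTwist (d : ℚ) ∧ BSTWScope.IsAuxiliaryTwist W₀ p d)
    {rk : ℕ} (hr : W.analyticRank = rk) (hrk : rk ≤ 1) : BSDp W p := by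
  have hp2 : p ≠ 2 := by omega
  obtain ⟨W₀, _, _, d, C, hsst, hss, hap, hd, hd1, hram, hC, haux⟩ := htw
  have hG := goodSS_of_twistBody W p hp2 ⟨W₀, ‹_›, ‹_›, d, C, hsst, hss, hap, hd, hd1, hram, hC⟩
  have hram' : ∀ (q : ℕ) [Fact q.Prime], RamifiedInQuadratic d q → q ≠ p ∧ ¬ q ∣ W₀.conductorNorm ℤ := by
    intro q _ h
    obtain ⟨hqp, hgood⟩ := hram q h
    exact ⟨hqp, fun hdvd ↦ (W₀.dvd_conductorNorm_iff_not_hasGoodReductionAtPrime q).mp hdvd hgood⟩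
  have hirr : Irr W p :=
    hasIrreducibleModPGaloisRep_of_dvd_frobeniusTrace W p hp2
      (W.not_dvd_minimalDiscriminantInt_of_hasGoodReductionAtPrime' p hG.1) hG.2
  exact bsdp_of_cor102_twist_scopedS_OPEN W₀ W p hBSTW hGZK hp5 hsst hss.1 hap hd hd1 hram' hC haux hirr (by omega)

/-- **`BSD(E, 3)` from a SCOPED twist datum, CONDITIONAL on the `p = 3` scoped tier** (which rests at 3 on the wall of record,
[SV-S-Ohta], GAP(line) C4-R3 (β)): as `bsdp_of_cor102_twist_scopedS_OPEN_of_twistAux` via `bsdp_of_cor102_twist_scopedAtThreeS_OPEN`.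
Closes nothing. [claim: BurungaleSkinnerTianWan2024, status: under-review]
[cite: BurungaleSkinnerTianWan2024, Cor. 10.2, last sentence (p. 86) with §10.3 (ANNOUNCED, OPEN binder, scoped, p = 3)]
[cite: Serre1972, §1.11 Prop. 12] [cite: Miller2011LMS, §1 and Def. 1.1] -/
theorem bsdp_of_cor102_twist_scopedAtThreeS_OPEN_of_twistAux
    (hBSTW : BurungaleSkinnerTianWan2024_cor102_twist_scopedAtThreeS_OPEN)
    (hGZK : rank_eq_analyticRank_of_analyticRank_le_one) (hp3 : p = 3)
    (htw : ∃ (W₀ : WeierstrassCurve ℚ) (_ : W₀.IsElliptic) (_ : W₀.IsGloballyMinimal) (d : ℤ) (C : VariableChange ℚ),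
      Semistable W₀ ∧ GoodSS W₀ p ∧ W₀.frobeniusTrace p = 0 ∧ Squarefree d ∧ d ≠ 1 ∧
      (∀ (q : ℕ) [Fact q.Prime], RamifiedInQuadratic d q → q ≠ p ∧ W₀.HasGoodReductionAtPrime q) ∧
      C • W = W₀.quadraticTwist (d : ℚ) ∧ BSTWScope.IsAuxiliaryTwist W₀ p d)
    {rk : ℕ} (hr : W.analyticRank = rk) (hrk : rk ≤ 1) : BSDp W p := by
  have hp2 : p ≠ 2 := by omega
  obtain ⟨W₀, _, _, d, C, hsst, hss, hap, hd, hd1, hram, hC, haux⟩ := htw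
  have hG := goodSS_of_twistBody W p hp2 ⟨W₀, ‹_›, ‹_›, d, C, hsst, hss, hap, hd, hd1, hram, hC⟩
  have hram' : ∀ (q : ℕ) [Fact q.Prime], RamifiedInQuadratic d q → q ≠ p ∧ ¬ q ∣ W₀.conductorNorm ℤ := by
    intro q _ h
    obtain ⟨hqp, hgood⟩ := hram q h
    exact ⟨hqp, fun hdvd ↦ (W₀.dvd_conductorNorm_iff_not_hasGoodReductionAtPrime q).mp hdvd hgood⟩
  have hirr : Irr W p :=
    hasIrreducibleModPGaloisRep_of_dvd_frobeniusTrace W p hp2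
      (W.not_dvd_minimalDiscriminantInt_of_hasGoodReductionAtPrime' p hG.1) hG.2
  exact bsdp_of_cor102_twist_scopedAtThreeS_OPEN W₀ W p hBSTW hGZK hp3 hsst hss.1 hap hd hd1 hram' hC haux hirr (by omega)

/-- **Kobayashi's signed main conjecture AT THE SCOPED TWIST, CONDITIONAL on the `p ≥ 5` MC-level scoped tier** (BSTW Thm.
10.1's twist clause restricted to the litref scope, `BurungaleSkinnerTianWan2024_thm101_twist_scopedS_OPEN`; UNREFEREED
preprint, never a theorem): from a scoped twist datum, for every sign. Closes nothing. [claim: BurungaleSkinnerTianWan2024, status: under-review]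
[cite: BurungaleSkinnerTianWan2024, Thm. 10.1, last sentence (p. 86) with §10.3 (ANNOUNCED, OPEN binder, scoped)]
[cite: Kobayashi2003, Conjecture (Main Conjecture) (p. 2) (shape of the conclusion only)] -/
theorem kobayashiMainConjecture_of_thm101_twist_scopedS_OPEN_of_twistAux
    (hBSTW : BurungaleSkinnerTianWan2024_thm101_twist_scopedS_OPEN) (hp5 : 5 ≤ p)
    (htw : ∃ (W₀ : WeierstrassCurve ℚ) (_ : W₀.IsElliptic) (_ : W₀.IsGloballyMinimal) (d : ℤ) (C : VariableChange ℚ),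
      Semistable W₀ ∧ GoodSS W₀ p ∧ W₀.frobeniusTrace p = 0 ∧ Squarefree d ∧ d ≠ 1 ∧
      (∀ (q : ℕ) [Fact q.Prime], RamifiedInQuadratic d q → q ≠ p ∧ W₀.HasGoodReductionAtPrime q) ∧
      C • W = W₀.quadraticTwist (d : ℚ) ∧ BSTWScope.IsAuxiliaryTwist W₀ p d) (ε : ℤˣ) :
    KobayashiMainConjecture W p ε := by
  obtain ⟨W₀, _, _, d, C, hsst, hss, hap, hd, hd1, hram, hC, haux⟩ := htw
  have hram' : ∀ (q : ℕ) [Fact q.Prime], RamifiedInQuadratic d q → q ≠ p ∧ ¬ q ∣ W₀.conductorNorm ℤ := by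
    intro q _ h
    obtain ⟨hqp, hgood⟩ := hram q h
    exact ⟨hqp, fun hdvd ↦ (W₀.dvd_conductorNorm_iff_not_hasGoodReductionAtPrime q).mp hdvd hgood⟩
  exact hBSTW W₀ W p d C hp5 hsst hss.1 hap hd hd1 hram' hC haux ε

/-- **The CRUX'S CONCLUSION `∃ ε, KobayashiLowerDivisibility W p ε` AT THE SCOPED TWIST** (item stmt-BirchSwinnertonDyer-19001's
statement per pair), CONDITIONAL on the `p ≥ 5` MC-level scoped tier (witness `ε = 1`; OPEN main conjecture ⇒ its lower half,
`kobayashiLowerDivisibility_of_mainConjecture`). The crux itself is untouched. [claim: BurungaleSkinnerTianWan2024, status: under-review]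
[cite: Kobayashi2003, Thm. 1.2, Thm. 4.1 and Conjecture (p. 2) (shape only)] -/
theorem exists_kobayashiLowerDivisibility_of_thm101_twist_scopedS_OPEN_of_twistAux
    (hBSTW : BurungaleSkinnerTianWan2024_thm101_twist_scopedS_OPEN) (hp5 : 5 ≤ p)
    (htw : ∃ (W₀ : WeierstrassCurve ℚ) (_ : W₀.IsElliptic) (_ : W₀.IsGloballyMinimal) (d : ℤ) (C : VariableChange ℚ),
      Semistable W₀ ∧ GoodSS W₀ p ∧ W₀.frobeniusTrace p = 0 ∧ Squarefree d ∧ d ≠ 1 ∧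
      (∀ (q : ℕ) [Fact q.Prime], RamifiedInQuadratic d q → q ≠ p ∧ W₀.HasGoodReductionAtPrime q) ∧
      C • W = W₀.quadraticTwist (d : ℚ) ∧ BSTWScope.IsAuxiliaryTwist W₀ p d) :
    ∃ ε : ℤˣ, KobayashiLowerDivisibility W p ε :=
  ⟨1, kobayashiLowerDivisibility_of_mainConjecture
    (kobayashiMainConjecture_of_thm101_twist_scopedS_OPEN_of_twistAux W p hBSTW hp5 htw 1)⟩

/-- The same at `p = 3`, CONDITIONAL on the `p = 3` MC-level scoped tier (resting on the wall of record at 3).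
[claim: BurungaleSkinnerTianWan2024, status: under-review] [cite: Kobayashi2003, Thm. 1.2, Thm. 4.1 and Conjecture (p. 2) (shape only)] -/
theorem exists_kobayashiLowerDivisibility_of_thm101_twist_scopedAtThreeS_OPEN_of_twistAux
    (hBSTW : BurungaleSkinnerTianWan2024_thm101_twist_scopedAtThreeS_OPEN) (hp3 : p = 3)
    (htw : ∃ (W₀ : WeierstrassCurve ℚ) (_ : W₀.IsElliptic) (_ : W₀.IsGloballyMinimal) (d : ℤ) (C : VariableChange ℚ),
      Semistable W₀ ∧ GoodSS W₀ p ∧ W₀.frobeniusTrace p = 0 ∧ Squarefree d ∧ d ≠ 1 ∧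
      (∀ (q : ℕ) [Fact q.Prime], RamifiedInQuadratic d q → q ≠ p ∧ W₀.HasGoodReductionAtPrime q) ∧
      C • W = W₀.quadraticTwist (d : ℚ) ∧ BSTWScope.IsAuxiliaryTwist W₀ p d) :
    ∃ ε : ℤˣ, KobayashiLowerDivisibility W p ε := by
  obtain ⟨W₀, _, _, d, C, hsst, hss, hap, hd, hd1, hram, hC, haux⟩ := htw
  have hram' : ∀ (q : ℕ) [Fact q.Prime], RamifiedInQuadratic d q → q ≠ p ∧ ¬ q ∣ W₀.conductorNorm ℤ := by
    intro q _ h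
    obtain ⟨hqp, hgood⟩ := hram q h
    exact ⟨hqp, fun hdvd ↦ (W₀.dvd_conductorNorm_iff_not_hasGoodReductionAtPrime q).mp hdvd hgood⟩
  exact ⟨1, kobayashiLowerDivisibility_of_mainConjecture (hBSTW W₀ W p d C hp3 hsst hss.1 hap hd hd1 hram' hC haux 1)⟩

end ScopedConsumers

end Summit.BirchSwinnertonDyer.BirchSwinnertonDyer.Theorems.X7Twist

end
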